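import Literature.Algebra.Homology.OrderedCechPieces
import Literature.Algebra.Homology.FlatQuasiIsoBaseChange
import HarnessLib

/-!
# Transfer lemmas for ordered Čech complexes: change of scalars, ambient isomorphisms, `Ȟ⁰`

Three pieces of bookkeeping for the ordered Čech complex `Č•(F)` of a monotone family
`F : Finset ι → Submodule A 𝕂` (`Literature/Algebra/Homology/OrderedCech`), used when the SAME
sections `Γ(W_s, 𝓕) ⊆ 𝕂` are viewed over two base rings (e.g. `A` and `Γ(U, 𝒪_V)` acting on a
function field) or inside two isomorphic ambient modules (`K(V) ≅ K(V')` for a birational `V' → V`):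

* `OrderedCech.exactAt_iff_of_coe_eq` — **exactness does not see the scalars**: for families
  `F` over `R₁` and `G` over `R₂` in the same additive group `𝕂` with `F s = G s` as sets (`s ≠ ∅`),
  `Č•(F)` is exact in degree `m` iff `Č•(G)` is (the cochain groups and the differential
  `(dg)_s = Σ ± g_{s∖a}` are the same; `Literature.Algebra.Homology.exactAt_iff_function_exact`);
* `OrderedCech.complexIsoOfLinearEquiv` — an `A`-linear isomorphism of ambient modules
  `e : 𝕂 ≅ 𝕃` carrying `F s` onto `G s` induces `Č•(F) ≅ Č•(G)` (`complexMapFamily` both ways);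
* `OrderedCech.moduleFinite_iInf_of_homology_zero` — **if `H⁰(Č•(F))` is finitely generated then
  so is `⋂_i F {i}`** (`= Ker d⁰ = Ȟ⁰`, `OrderedCech.kerDZeroEquiv`; there are no `(-1)`-cochains).

Everything is proved; no named facts.

## References

* U. Görtz, T. Wedhorn, *Algebraic Geometry II* (2023): Def. 21.68, Lemma 21.65 (pp. 259–260).
  [GortzWedhorn2023]
-/

noncomputable section

open CategoryTheory

universe u v

namespace Literature.Algebra.Homology

namespace OrderedCech

variable {ι : Type} [LinearOrder ι]

/-! ### Change of scalars: exactness only depends on the underlying additive data -/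

section CrossRing

variable {R₁ R₂ : Type u} [CommRing R₁] [CommRing R₂] {𝕂 : Type v} [AddCommGroup 𝕂]
  [Module R₁ 𝕂] [Module R₂ 𝕂] {F : Finset ι → Submodule R₁ 𝕂} {G : Finset ι → Submodule R₂ 𝕂}

/-- `(-1)^k` acts on `𝕂` independently of the ring through which it acts. [folklore] -/
theorem neg_one_pow_smul_eq (k : ℕ) (x : 𝕂) : ((-1 : R₁) ^ k) • x = ((-1 : R₂) ^ k) • x := by
  induction k generalizing x with
  | zero => rw [pow_zero, pow_zero, one_smul, one_smul]
  | succ k ih =>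
    rw [pow_succ, pow_succ, mul_smul, mul_smul, neg_one_smul, neg_one_smul]
    exact ih (-x)

/-- The signs of the Čech differential act identically through both rings. [folklore] -/
theorem sign_smul_eq (s : Finset ι) (a : ι) (x : 𝕂) : sign R₁ s a • x = sign R₂ s a • x :=
  neg_one_pow_smul_eq _ x

variable (h : ∀ s : Finset ι, s.Nonempty → ((F s : Set 𝕂) = G s))

/-- Copying a cochain of `F` to a cochain of `G` (same values in `𝕂`). [folklore] -/
def Cochain.copy (n : ℤ) (g : Cochain F n) : Cochain G n := fun σ =>
  ⟨(g σ : 𝕂), by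
    have hm : ((g σ : 𝕂)) ∈ (F σ.1 : Set 𝕂) := (g σ).2
    rw [h σ.1 σ.2.1] at hm
    exact hm⟩

/-- The values of a copied cochain. [folklore] -/
@[simp] theorem Cochain.coe_copy_apply {n : ℤ} (g : Cochain F n) (σ : Simplex ι n) :
    ((Cochain.copy h n g σ : G σ.1) : 𝕂) = g σ := rfl

/-- Copying twice is the identity. [folklore] -/
theorem Cochain.copy_copy {n : ℤ} (g : Cochain F n) :
    Cochain.copy (F := G) (G := F) (fun s hs => (h s hs).symm) n (Cochain.copy h n g) = g :=
  funext fun _ => Subtype.ext rfl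

/-- Copying is additive. [folklore] -/
theorem Cochain.copy_add {n : ℤ} (g g' : Cochain F n) :
    Cochain.copy h n (g + g') = Cochain.copy h n g + Cochain.copy h n g' :=
  funext fun _ => Subtype.ext rfl

/-- Copying preserves zero. [folklore] -/
theorem Cochain.copy_zero {n : ℤ} : Cochain.copy h n (0 : Cochain F n) = 0 :=
  funext fun _ => Subtype.ext rfl

/-- Copying is bijective. [folklore] -/
theorem Cochain.copy_bijective (n : ℤ) : Function.Bijective (Cochain.copy h n) := by
  refine Function.bijective_iff_has_inverse.2 ⟨Cochain.copy (fun s hs => (h s hs).symm) n, ?_, ?_⟩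
  · intro g; exact Cochain.copy_copy h g
  · intro g; exact Cochain.copy_copy (fun s hs => (h s hs).symm) g

/-- Copying commutes with extension by zero. [folklore] -/
theorem Cochain.ext0_copy {n : ℤ} (g : Cochain F n) (s : Finset ι) :
    (Cochain.copy h n g).ext0 s = g.ext0 s := by
  unfold Cochain.ext0
  split_ifs <;> rfl

variable (hF : Monotone F) (hG : Monotone G)

/-- **Copying commutes with the Čech differentials** (same formula, signs acting identically).
[folklore] -/
theorem d_copy {n : ℤ} (g : Cochain F n) :
    d G hG n (Cochain.copy h n g) = Cochain.copy h (n + 1) (d F hF n g) := by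
  funext σ
  apply Subtype.ext
  rw [coe_d_apply, Cochain.coe_copy_apply, coe_d_apply]
  refine Finset.sum_congr rfl fun a _ => ?_
  rw [Cochain.ext0_copy]
  exact sign_smul_eq _ _ _

/-- Exactness of a pair of composable additive maps transfers along a ladder of bijections.
[folklore] -/
theorem function_exact_of_ladder {M₁ M₂ M₃ N₁ N₂ N₃ : Type*} [AddCommGroup M₁] [AddCommGroup M₂]
    [AddCommGroup M₃] [AddCommGroup N₁] [AddCommGroup N₂] [AddCommGroup N₃]
    {f : M₁ → M₂} {g : M₂ → M₃} {f' : N₁ → N₂} {g' : N₂ → N₃}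
    (α : M₁ → N₁) (β : M₂ → N₂) (γ : M₃ → N₃) (hβ : Function.Bijective β) (hγ0 : γ 0 = 0)
    (hγ : Function.Injective γ) (hg'0 : ∀ x, g' (f' x) = 0)
    (h₁ : ∀ x, β (f x) = f' (α x)) (h₂ : ∀ y, γ (g y) = g' (β y)) (hex : Function.Exact f g) :
    Function.Exact f' g' := by
  intro y'
  constructor
  · intro hy'
    obtain ⟨y, rfl⟩ := hβ.2 y'
    have hgy : g y = 0 := hγ (by rw [h₂, hy', hγ0])
    obtain ⟨x, rfl⟩ := (hex y).1 hgy
    exact ⟨α x, (h₁ x).symm⟩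
  · rintro ⟨x', rfl⟩
    exact hg'0 x'

include h in
/-- **Exactness of the ordered Čech complex does not depend on the ring of scalars**: if
`F s = G s` as subsets of `𝕂` for all `s ≠ ∅`, then `Č•(F)` (over `R₁`) is exact in degree `m` iff
`Č•(G)` (over `R₂`) is. [folklore] -/
theorem exactAt_iff_of_coe_eq (m : ℤ) : (complex F hF).ExactAt m ↔ (complex G hG).ExactAt m := by
  have key : ∀ {R₁ R₂ : Type u} [CommRing R₁] [CommRing R₂] [Module R₁ 𝕂] [Module R₂ 𝕂]
      {F : Finset ι → Submodule R₁ 𝕂} {G : Finset ι → Submodule R₂ 𝕂} (hF : Monotone F)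
      (hG : Monotone G) (h : ∀ s : Finset ι, s.Nonempty → ((F s : Set 𝕂) = G s)),
      (complex F hF).ExactAt m → (complex G hG).ExactAt m := by
    intro R₁ R₂ _ _ _ _ F G hF hG h hex
    obtain ⟨p, rfl⟩ : ∃ p : ℤ, m = p + 1 := ⟨m - 1, by omega⟩
    rw [exactAt_iff_function_exact _ p (p + 1) (p + 1 + 1) rfl rfl, complex_d, complex_d] at hex ⊢
    change Function.Exact (d F hF p) (d F hF (p + 1)) at hex
    change Function.Exact (d G hG p) (d G hG (p + 1))
    -- the ladder of copies (degrees `p`, `p + 1`, `p + 2`)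
    refine function_exact_of_ladder (Cochain.copy h p) (Cochain.copy h (p + 1))
      (Cochain.copy h (p + 1 + 1)) (Cochain.copy_bijective h (p + 1)) (Cochain.copy_zero h)
      (Cochain.copy_bijective h (p + 1 + 1)).1 (fun x => d_d G hG p x) (fun x => ?_) (fun y => ?_) hex
    · exact (d_copy h hF hG x).symm
    · exact (d_copy h hF hG y).symm
  exact ⟨key hF hG h, key hG hF fun s hs => (h s hs).symm⟩

end CrossRing

/-! ### Isomorphic ambient modules -/

section Ambient

variable {A : Type u} [CommRing A] {𝕂 : Type v} [AddCommGroup 𝕂] [Module A 𝕂] {𝕃 : Type v}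
  [AddCommGroup 𝕃] [Module A 𝕃] (e : 𝕂 ≃ₗ[A] 𝕃)
  {F : Finset ι → Submodule A 𝕂} {G : Finset ι → Submodule A 𝕃} (hF : Monotone F) (hG : Monotone G)
  (h : ∀ (s : Finset ι) (x : 𝕂), x ∈ F s ↔ e x ∈ G s)

/-- The memberwise maps `F s → G s` induced by `e`. [folklore] -/
def ambientMap (s : Finset ι) : F s →ₗ[A] G s :=
  (e.toLinearMap.domRestrict (F s)).codRestrict (G s) fun x => (h s x).1 x.2

omit [LinearOrder ι] in
/-- The values of `ambientMap`. [folklore] -/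
@[simp] theorem coe_ambientMap (s : Finset ι) (x : F s) : ((ambientMap e h s x : G s) : 𝕃) = e x := rfl

/-- The memberwise maps `G s → F s` induced by `e⁻¹`. [folklore] -/
def ambientInv (s : Finset ι) : G s →ₗ[A] F s :=
  (e.symm.toLinearMap.domRestrict (G s)).codRestrict (F s) fun y =>
    (h s (e.symm y)).2 (by rw [LinearEquiv.apply_symm_apply]; exact y.2)

omit [LinearOrder ι] in
/-- The values of `ambientInv`. [folklore] -/
@[simp] theorem coe_ambientInv (s : Finset ι) (y : G s) : ((ambientInv e h s y : F s) : 𝕂) = e.symm y :=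
  rfl

/-- **An `A`-linear isomorphism of ambient modules carrying `F s` onto `G s` induces an
isomorphism of ordered Čech complexes `Č•(F) ≅ Č•(G)`.** [folklore] -/
def complexIsoOfLinearEquiv : complex F hF ≅ complex G hG where
  hom := complexMapFamily (ambientMap e h) hF hG fun _ _ _ _ _ => by rw [coe_ambientMap, coe_ambientMap]
  inv := complexMapFamily (ambientInv e h) hG hF fun _ _ _ _ _ => by rw [coe_ambientInv, coe_ambientInv]
  hom_inv_id := by
    ext n g
    change Cochain.mapFamily (ambientInv e h) n (Cochain.mapFamily (ambientMap e h) n g) = g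
    funext σ
    apply Subtype.ext
    rw [Cochain.mapFamily_apply, Cochain.mapFamily_apply, coe_ambientInv, coe_ambientMap,
      LinearEquiv.symm_apply_apply]
  inv_hom_id := by
    ext n g
    change Cochain.mapFamily (ambientMap e h) n (Cochain.mapFamily (ambientInv e h) n g) = g
    funext σ
    apply Subtype.ext
    rw [Cochain.mapFamily_apply, Cochain.mapFamily_apply, coe_ambientMap, coe_ambientInv,
      LinearEquiv.apply_symm_apply]

include e h in
/-- Finite generation of Čech cohomology transfers along an ambient isomorphism. [folklore] -/
theorem moduleFinite_homology_of_linearEquiv (i : ℤ)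
    (hfin : Module.Finite A ((complex G hG).homology i)) : Module.Finite A ((complex F hF).homology i) := by
  haveI : Module.Finite A ((HomologicalComplex.homologyFunctor (ModuleCat A) (ComplexShape.up ℤ) i).obj
      (complex G hG)) := hfin
  exact Module.Finite.equiv
    ((HomologicalComplex.homologyFunctor _ _ i).mapIso
      (complexIsoOfLinearEquiv e hF hG h)).toLinearEquiv.symm

end Ambient

/-! ### `Ȟ⁰ = ⋂_i F {i}` is finitely generated when `H⁰` is -/

section H0

variable {A : Type u} [CommRing A] {𝕂 : Type v} [AddCommGroup 𝕂] [Module A 𝕂]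
  (F : Finset ι → Submodule A 𝕂) (hF : Monotone F)

/-- **`Ker d⁰` is finitely generated when `H⁰(Č•(F))` is** (there are no `(-1)`-cochains, so no
boundaries in degree `0`). [folklore] -/
theorem moduleFinite_ker_d_zero (hfin : Module.Finite A ((complex F hF).homology 0)) :
    Module.Finite A (LinearMap.ker (d F hF 0)) := by
  have hg : ((complex F hF).sc' (-1) 0 1).g = ModuleCat.ofHom (d F hF 0) := complex_d F hF 0
  have e : (complex F hF).homology 0 ≅ ((complex F hF).sc' (-1) 0 1).moduleCatLeftHomologyData.H :=
    (complex F hF).homologyIsoSc' (-1) 0 1 (by simp) (by simp) ≪≫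
      ((complex F hF).sc' (-1) 0 1).moduleCatHomologyIso
  have hfin' : Module.Finite A ((complex F hF).sc' (-1) 0 1).moduleCatLeftHomologyData.H :=
    Module.Finite.equiv e.toLinearEquiv
  have hbot : LinearMap.range ((complex F hF).sc' (-1) 0 1).moduleCatToCycles = ⊥ := by
    haveI := isEmpty_simplex_of_neg (ι := ι) (n := -1) (by norm_num)
    rw [LinearMap.range_eq_bot]
    ext x
    have hx : x = 0 := Subsingleton.elim (α := Cochain F (-1)) x 0
    rw [hx, map_zero, LinearMap.zero_apply]
  rw [ShortComplex.moduleCatLeftHomologyData_H, hbot] at hfin'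
  haveI : Module.Finite A (LinearMap.ker ((complex F hF).sc' (-1) 0 1).g.hom ⧸
      (⊥ : Submodule A (LinearMap.ker ((complex F hF).sc' (-1) 0 1).g.hom))) := hfin'
  have h := Module.Finite.equiv
    (Submodule.quotEquivOfEqBot (⊥ : Submodule A (LinearMap.ker ((complex F hF).sc' (-1) 0 1).g.hom)) rfl)
  rwa [hg] at h

/-- **`⋂_i F {i}` (`= Ȟ⁰`, Görtz–Wedhorn II, Lemma 21.65) is finitely generated when `H⁰(Č•(F))` is.**
[cite: GortzWedhorn2023, Lemma 21.65 (p. 259)] -/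
theorem moduleFinite_iInf_of_homology_zero [Inhabited ι]
    (hfin : Module.Finite A ((complex F hF).homology 0)) :
    Module.Finite A (⨅ i : ι, F {i} : Submodule A 𝕂) :=
  haveI := moduleFinite_ker_d_zero F hF hfin
  Module.Finite.equiv (kerDZeroEquiv F hF)

end H0

end OrderedCech

end Literature.Algebra.Homology

end
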